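import Summits.Ventures.HodgeRepro2.T5SU11RadialGreenImproperOrigin
import Summits.Ventures.HodgeRepro2.T5SU11ResolventIdentity

/-!
# The source `G_{λ₂} f` is admissible for the improper Green's operator `G^I_λ`

For `λ, λ₂ > 1` and a continuous source `f` supported in `[a, b] ⊂ (0, ∞)`, the Green's solution `g = G_{λ₂} f`
(rows 451–452) satisfies the hypotheses of rows 492–493 for the basis `(φ_λ, χ_λ)`:

* `g` is continuous on `(0, ∞)` and **bounded on `(0, 1]`** (`exists_abs_sphGreen_le_of_le_one`: `g = −c₁ φ_{λ₂}`
  on `(0, a]`, continuous on the compact `[a, 1]`);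
* **`φ_λ g sinh 2s` is integrable on every `(0, T]`** (`integrableOn_sph_mul_sphGreen_mul_sinh_Ioc`);
* **`χ_λ g sinh 2s` is integrable on `(0, ∞)`** (`integrableOn_sphDecay_mul_sphGreen_mul_sinh`): on `(0, 1]` the
  integrand is bounded — `χ_λ ≤ Φ (T_λ(1) + (−log s)/(2m))` (row 493), `sinh 2s ≤ 2 e² s` (`sinh_le_mul_exp`) and
  `−s log s ≤ 1` —, on `[1, T]` continuous, and on `(T, ∞)` dominated by `C e^{(2−λ−λ₂)s}` (`g = −c₂ χ_{λ₂}` on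
  `[b, ∞)`, the exponential bounds of rows 450 and 473).

Hence `G^I_λ(G_{λ₂} f)` is defined, solves `(L − μ)u = G_{λ₂} f` and is bounded at the origin (rows 492–493).
Nothing is claimed about (N).

Blind lane: Mathlib + the HodgeRepro2 prefix only; no sorry; axioms ⊆ {propext, Classical.choice,
Quot.sound}.
-/

namespace Summit.Ventures.HodgeRepro2.T5SU11ResolventSourceIntegrable

open Filter Topology MeasureTheory intervalIntegral
open Set (Ioi Ioc Icc)
open T5SU11Cartan T5SU11SphericalFunction T5SU11SphericalBounds T5SU11SphericalContinuous
  T5SU11SphericalSolutionSpaceAll T5SU11ReductionOfOrder T5SU11ReductionOfOrderInfinity T5SU11SphericalDecay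
  T5SU11SphericalDecayAsymptotic T5SU11SphericalDecayBracket T5SU11SphericalGreen T5SU11ResolventTransform
  T5SU11ResolventBoundary T5SU11RadialGreenImproperOrigin

/-- `sinh x ≤ x e^x` for `x ≥ 0`. -/
theorem sinh_le_mul_exp {x : ℝ} (hx : 0 ≤ x) : Real.sinh x ≤ x * Real.exp x := by
  rw [Real.sinh_eq]
  have h1 : 1 - x ≤ Real.exp (-x) := by
    have := Real.add_one_le_exp (-x)
    linarith
  have h2 : Real.exp x - 1 ≤ x * Real.exp x := by
    have := mul_le_mul_of_nonneg_left h1 (Real.exp_pos x).le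
    rw [← Real.exp_add, add_neg_cancel, Real.exp_zero] at this
    linarith
  have h4 : 1 ≤ Real.exp x := Real.one_le_exp hx
  nlinarith [h1, h2, h4, hx]

/-- `−s log s ≤ 1` for `s > 0`. -/
theorem neg_mul_log_le_one {s : ℝ} (hs : 0 < s) : -(s * Real.log s) ≤ 1 := by
  have h := Real.one_sub_inv_le_log_of_pos hs
  have h' : s * (1 - s⁻¹) ≤ s * Real.log s := mul_le_mul_of_nonneg_left h hs.le
  rw [mul_sub, mul_one, mul_inv_cancel₀ hs.ne'] at h'
  linarith

section measure

variable [MeasurableSpace Circle] [BorelSpace Circle]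

variable {lam lam₂ a b : ℝ} {f : ℝ → ℝ} (hlam : 1 < lam) (hlam₂ : 1 < lam₂) (hf : ContinuousOn f (Ioi 0))
  (ha : 0 < a) (hab : a ≤ b) (hfa : ∀ s, s ≤ a → f s = 0) (hfb : ∀ s, b ≤ s → f s = 0)

include hlam₂ hf ha hab in
/-- `G_{λ₂} f` is continuous on `(0, ∞)`. -/
theorem continuousOn_sphGreen : ContinuousOn (sphGreen lam₂ f a b) (Ioi 0) :=
  fun _ ht => (hasDerivAt_sphGreen hlam₂ hf ha hab ht).continuousAt.continuousWithinAt

include hlam₂ hf ha hab hfa in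
/-- **`G_{λ₂} f` is bounded on `(0, 1]`.** -/
theorem exists_abs_sphGreen_le_of_le_one :
    ∃ M : ℝ, 0 ≤ M ∧ ∀ s ∈ Ioc (0 : ℝ) 1, |sphGreen lam₂ f a b s| ≤ M := by
  set c₁ := ∫ s in a..b, sphDecay lam₂ s * f s * Real.sinh (2 * s) with hc₁
  obtain ⟨Φ, _, hΦle⟩ := exists_sph_hyp_le lam₂
  have hcont : ContinuousOn (sphGreen lam₂ f a b) (Icc a 1) :=
    (continuousOn_sphGreen hlam₂ hf ha hab).mono (fun s hs => lt_of_lt_of_le ha hs.1)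
  obtain ⟨C, hC⟩ := isCompact_Icc.exists_bound_of_continuousOn hcont
  refine ⟨max (|c₁| * Φ) C, le_max_of_le_left (by positivity), fun s hs => ?_⟩
  rcases le_or_gt s a with hsa | hsa
  · rw [sphGreen_eq_of_le hlam₂ hf ha hab hfa hs.1 hsa, abs_mul, abs_neg, abs_of_pos (sph_hyp_pos _ _)]
    exact le_max_of_le_left (mul_le_mul_of_nonneg_left (hΦle s ⟨hs.1.le, hs.2⟩) (abs_nonneg _))
  · have := hC s ⟨hsa.le, hs.2⟩
    rw [Real.norm_eq_abs] at this
    exact le_max_of_le_right this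

include hlam₂ hf ha hab hfa in
/-- **`φ_λ · G_{λ₂} f · sinh 2s` is integrable on every `(0, T]`.** -/
theorem integrableOn_sph_mul_sphGreen_mul_sinh_Ioc (T : ℝ) :
    IntegrableOn (fun s => sph lam (hyp s) * sphGreen lam₂ f a b s * Real.sinh (2 * s)) (Ioc 0 T) := by
  set c₁ := ∫ s in a..b, sphDecay lam₂ s * f s * Real.sinh (2 * s) with hc₁
  have hg : Continuous fun s => sph lam (hyp s) * (-c₁ * sph lam₂ (hyp s)) * Real.sinh (2 * s) :=
    ((continuous_sph_hyp lam).mul (continuous_const.mul (continuous_sph_hyp lam₂))).mul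
      (Real.continuous_sinh.comp (continuous_const.mul continuous_id))
  have hcont : ContinuousOn (fun s => sph lam (hyp s) * sphGreen lam₂ f a b s * Real.sinh (2 * s)) (Ioi 0) :=
    ((continuous_sph_hyp lam).continuousOn.mul (continuousOn_sphGreen hlam₂ hf ha hab)).mul
      (Real.continuous_sinh.comp (continuous_const.mul continuous_id)).continuousOn
  have hI1 : IntegrableOn (fun s => sph lam (hyp s) * sphGreen lam₂ f a b s * Real.sinh (2 * s)) (Ioc 0 a) := by
    refine (hg.integrableOn_Icc.mono_set Set.Ioc_subset_Icc_self).congr_fun (fun s hs => ?_) measurableSet_Ioc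
    rw [sphGreen_eq_of_le hlam₂ hf ha hab hfa hs.1 hs.2]
  have hI2 : IntegrableOn (fun s => sph lam (hyp s) * sphGreen lam₂ f a b s * Real.sinh (2 * s)) (Ioc a T) :=
    ((hcont.mono (fun s hs => lt_of_lt_of_le ha hs.1)).integrableOn_Icc).mono_set Set.Ioc_subset_Icc_self
  rcases le_or_gt a T with haT | haT
  · have := hI1.union hI2
    rwa [Set.Ioc_union_Ioc_eq_Ioc ha.le haT] at this
  · exact hI1.mono_set (Set.Ioc_subset_Ioc_right haT.le)

include hlam hlam₂ hf ha hab hfa in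
/-- **`χ_λ · G_{λ₂} f · sinh 2s` is integrable on `(0, 1]`** (bounded: `χ_λ` is `O(log(1/s))`, `sinh 2s = O(s)`). -/
theorem integrableOn_sphDecay_mul_sphGreen_mul_sinh_Ioc_one :
    IntegrableOn (fun s => sphDecay lam s * sphGreen lam₂ f a b s * Real.sinh (2 * s)) (Ioc 0 1) := by
  obtain ⟨M, hM0, hM⟩ := exists_abs_sphGreen_le_of_le_one hlam₂ hf ha hab hfa
  obtain ⟨m, hm, hmin⟩ := exists_sph_hyp_sq_ge lam
  obtain ⟨Φ, hΦ, hΦle⟩ := exists_sph_hyp_le lam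
  set T1 := tailIntegral (fun t => sph lam (hyp t)) 1 with hT1
  have hT1pos : 0 < T1 :=
    tailIntegral_pos (hφ_sph lam) (hpos_sph lam) (integrableOn_roIntegrand_sph hlam) one_pos
  have hcont : ContinuousOn (fun s => sphDecay lam s * sphGreen lam₂ f a b s * Real.sinh (2 * s)) (Ioc 0 1) := by
    have hχ : ContinuousOn (sphDecay lam) (Ioi 0) :=
      fun t ht => (hasDerivAt_sphDecay hlam ht).continuousAt.continuousWithinAt
    exact ((hχ.mul (continuousOn_sphGreen hlam₂ hf ha hab)).mul
      (Real.continuous_sinh.comp (continuous_const.mul continuous_id)).continuousOn).mono (fun s hs => hs.1)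
  set C := Φ * (T1 + 1 / (2 * m)) * M * (2 * Real.exp 2) with hC
  refine (integrableOn_const (C := C) (by rw [Real.volume_Ioc]; exact ENNReal.ofReal_ne_top)).mono'
    (hcont.aestronglyMeasurable measurableSet_Ioc) ?_
  refine ae_restrict_of_forall_mem measurableSet_Ioc (fun s hs => ?_)
  have hs0 : 0 < s := hs.1
  have hT := tailIntegral_le_of_le_one hlam hm hmin hs0 hs.2
  have hTpos : 0 < tailIntegral (fun t => sph lam (hyp t)) s :=
    tailIntegral_pos (hφ_sph lam) (hpos_sph lam) (integrableOn_roIntegrand_sph hlam) hs0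
  have hlog : 0 ≤ -Real.log s := neg_nonneg.mpr (Real.log_nonpos hs0.le hs.2)
  have hsinh : Real.sinh (2 * s) ≤ 2 * Real.exp 2 * s := by
    calc Real.sinh (2 * s) ≤ 2 * s * Real.exp (2 * s) := sinh_le_mul_exp (by linarith)
      _ ≤ 2 * s * Real.exp 2 := by
          refine mul_le_mul_of_nonneg_left (Real.exp_le_exp.mpr (by linarith [hs.2])) (by linarith)
      _ = 2 * Real.exp 2 * s := by ring
  have hχ : sphDecay lam s ≤ Φ * (T1 + (-Real.log s) / (2 * m)) := by
    show sph lam (hyp s) * tailIntegral (fun t => sph lam (hyp t)) s ≤ _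
    exact mul_le_mul (hΦle s ⟨hs0.le, hs.2⟩) hT hTpos.le hΦ.le
  have hχ0 : 0 ≤ sphDecay lam s := (sphDecay_pos hlam hs0).le
  have hs0' : 0 ≤ Real.sinh (2 * s) := Real.sinh_nonneg_iff.mpr (by linarith)
  rw [Real.norm_eq_abs, abs_mul, abs_mul, abs_of_nonneg hχ0, abs_of_nonneg hs0']
  -- `χ_λ(s) |g(s)| sinh 2s ≤ Φ (T1 + (−log s)/(2m)) M (2 e² s) = 2 e² Φ M (T1 s + (−s log s)/(2m)) ≤ C`
  calc sphDecay lam s * |sphGreen lam₂ f a b s| * Real.sinh (2 * s)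
      ≤ (Φ * (T1 + (-Real.log s) / (2 * m))) * M * (2 * Real.exp 2 * s) :=
        mul_le_mul (mul_le_mul hχ (hM s hs) (abs_nonneg _)
          (mul_nonneg hΦ.le (add_nonneg hT1pos.le (div_nonneg hlog (by positivity))))) hsinh hs0'
          (mul_nonneg (mul_nonneg hΦ.le (add_nonneg hT1pos.le (div_nonneg hlog (by positivity)))) hM0)
    _ = Φ * M * (2 * Real.exp 2) * (T1 * s + (-(s * Real.log s)) / (2 * m)) := by
        field_simp
    _ ≤ Φ * M * (2 * Real.exp 2) * (T1 + 1 / (2 * m)) := by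
        refine mul_le_mul_of_nonneg_left ?_ (by positivity)
        have h1 : T1 * s ≤ T1 := mul_le_of_le_one_right hT1pos.le hs.2
        have h2 : (-(s * Real.log s)) / (2 * m) ≤ 1 / (2 * m) :=
          div_le_div_of_nonneg_right (neg_mul_log_le_one hs0) (by positivity)
        linarith
    _ = C := by rw [hC]; ring

include hlam hlam₂ hf ha hab hfa hfb in
/-- **`χ_λ · G_{λ₂} f · sinh 2s` is integrable on `(0, ∞)`**: `O(e^{(2−λ−λ₂)s})` at infinity. -/
theorem integrableOn_sphDecay_mul_sphGreen_mul_sinh :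
    IntegrableOn (fun s => sphDecay lam s * sphGreen lam₂ f a b s * Real.sinh (2 * s)) (Ioi 0) := by
  have hb : 0 < b := lt_of_lt_of_le ha hab
  set c₂ := ∫ s in a..b, sph lam₂ (hyp s) * f s * Real.sinh (2 * s) with hc₂
  set L := 1 / ((lam - 1) * T5SU11SphericalAsymptotic.cfun (2 - lam)) with hL
  set L₂ := 1 / ((lam₂ - 1) * T5SU11SphericalAsymptotic.cfun (2 - lam₂)) with hL₂
  have hLpos : 0 < L := sphDecay_limit_pos hlam
  have hL₂pos : 0 < L₂ := sphDecay_limit_pos hlam₂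
  obtain ⟨T₀, hT₀⟩ := eventually_atTop.mp (eventually_sphDecay_le hlam)
  obtain ⟨T₁, hT₁⟩ := eventually_atTop.mp (eventually_sphDecay_le hlam₂)
  set T := max (max T₀ T₁) (max b 1) with hT
  have hbT : b ≤ T := le_trans (le_max_left _ _) (le_max_right _ _)
  have h1T : 1 ≤ T := le_trans (le_max_right _ _) (le_max_right _ _)
  have hcont : ContinuousOn (fun s => sphDecay lam s * sphGreen lam₂ f a b s * Real.sinh (2 * s)) (Ioi 0) := by
    have hχ : ContinuousOn (sphDecay lam) (Ioi 0) :=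
      fun t ht => (hasDerivAt_sphDecay hlam ht).continuousAt.continuousWithinAt
    exact (hχ.mul (continuousOn_sphGreen hlam₂ hf ha hab)).mul
      (Real.continuous_sinh.comp (continuous_const.mul continuous_id)).continuousOn
  -- `(0, 1]`
  have hI1 := integrableOn_sphDecay_mul_sphGreen_mul_sinh_Ioc_one hlam hlam₂ hf ha hab hfa
  -- `(1, T]`
  have hI2 : IntegrableOn (fun s => sphDecay lam s * sphGreen lam₂ f a b s * Real.sinh (2 * s)) (Ioc 1 T) :=
    ((hcont.mono (fun s hs => lt_of_lt_of_le one_pos hs.1)).integrableOn_Icc).mono_set Set.Ioc_subset_Icc_self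
  -- `(T, ∞)`
  have hI3 : IntegrableOn (fun s => sphDecay lam s * sphGreen lam₂ f a b s * Real.sinh (2 * s)) (Ioi T) := by
    set C := |c₂| * (2 * L) * (2 * L₂) / 2 with hC
    have hmaj : IntegrableOn (fun s => C * Real.exp (-(lam + lam₂ - 2) * s)) (Ioi T) :=
      (exp_neg_integrableOn_Ioi T (by linarith)).const_mul _
    refine hmaj.mono' ?_ ?_
    · exact (hcont.mono (Set.Ioi_subset_Ioi (by linarith))).aestronglyMeasurable measurableSet_Ioi
    · refine ae_restrict_of_forall_mem measurableSet_Ioi (fun s hs => ?_)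
      have hs' : T < s := hs
      have hsb : b ≤ s := le_trans hbT hs'.le
      have hs0 : 0 < s := lt_of_lt_of_le hb hsb
      have hb1 := hT₀ s (le_trans (le_trans (le_max_left _ _) (le_max_left _ _)) hs'.le)
      have hb2 := hT₁ s (le_trans (le_trans (le_max_right _ _) (le_max_left _ _)) hs'.le)
      rw [sphGreen_eq_of_ge hf ha hab hfb hsb, Real.norm_eq_abs]
      have hsh : Real.sinh (2 * s) ≤ Real.exp (2 * s) / 2 := sinh_le_exp_div_two _
      have hsh0 : 0 ≤ Real.sinh (2 * s) := Real.sinh_nonneg_iff.mpr (by linarith)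
      have hχ0 : 0 ≤ sphDecay lam s := (sphDecay_pos hlam hs0).le
      have hχ₂0 : 0 ≤ sphDecay lam₂ s := (sphDecay_pos hlam₂ hs0).le
      rw [abs_mul, abs_mul, abs_of_nonneg hχ0, abs_of_nonneg hsh0, abs_mul, abs_neg,
        abs_of_nonneg hχ₂0]
      calc sphDecay lam s * (|c₂| * sphDecay lam₂ s) * Real.sinh (2 * s)
          ≤ (2 * L * Real.exp (-lam * s)) * (|c₂| * (2 * L₂ * Real.exp (-lam₂ * s))) * (Real.exp (2 * s) / 2) :=
            mul_le_mul (mul_le_mul hb1 (mul_le_mul_of_nonneg_left hb2 (abs_nonneg _)) (by positivity)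
              (by positivity)) hsh hsh0 (by positivity)
        _ = C * Real.exp (-(lam + lam₂ - 2) * s) := by
            rw [hC, show Real.exp (-(lam + lam₂ - 2) * s)
                = Real.exp (-lam * s) * Real.exp (-lam₂ * s) * Real.exp (2 * s) by
              rw [← Real.exp_add, ← Real.exp_add]; congr 1; ring]
            ring
  have h12 := hI1.union hI2
  rw [Set.Ioc_union_Ioc_eq_Ioc zero_le_one h1T] at h12
  have := h12.union hI3
  rwa [Set.Ioc_union_Ioi_eq_Ioi (le_trans zero_le_one h1T)] at this

end measure

end Summit.Ventures.HodgeRepro2.T5SU11ResolventSourceIntegrable
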